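import Summits.BirchSwinnertonDyer.BirchSwinnertonDyer.Theorems.ClassRecordThreeEulerHalvesAtThreeFromUB
import Summits.BirchSwinnertonDyer.Rank1Residual.X11b.BDPRouteNoRam
import Summits.BirchSwinnertonDyer.Rank1Residual.X11b.Three.TamagawaAtomShapes
import HarnessLib

/-!
# Routes `ClassRecordThree` ∕ `KolyvaginRoadThree`, crux `EulerHalvesAtThree` (item stmt-BirchSwinnertonDyer-19109): the
# ¬(ram) ∧ surj clause at `p = 3` from UB∃ᴮ@3 + TL₃, and the crux's BODY (all three clauses) — part 2 of
# `Theorems/ClassRecordThreeEulerHalvesAtThreeFromUB.lean` (split for the 400-line rule; see its docstring for UB∃ᴮ@3)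

Cell `bsd-stepL` (run/shared/lean/pub/bsd-stepL/), seat `bsd-stepL-bdp` (prover g19, 2026-08-27).
`--supports stmt-BirchSwinnertonDyer-19109 --as helper`. THEOREMS ONLY; THESES-FREE.

* §3 `missingUpperBoundAt_three_of_classX11b_of_surj_of_ubB₃_of_twistLower` — X11b@3 ∧ surj (ANY (ram) status):
  `Typed.MissingUpperBoundAt W 3` from UB∃ᴮ@3 + H2@3 (`Three.BDPValueAt₃ W`, a theorem from LZZ) + PUBLISHED facts (`h331`,
  GZ, Kolyvagin, GZK, modularity ×2, Hoffstein–Luo, Mazur) + the twist's `≥`-half from TL₃ = the registered stub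
  `stub_twistLowerAtThree` of 19109's birth skeleton VERBATIM (the twist on its minimal model is multiplicative and
  irreducible at 3 with `L ≠ 0` and finite `Ш`). NO Tamagawa condition, NO Shimura curve, NO `3`-adic height.
* §4 `eulerHalvesAtThree_body_of_ubB₃` — the BODY of `EulerHalvesAtThree` (byte-identical on both @3 routes) from
  {UB∃ᴮ@3 on X11b@3, H2@3 on X11b@3, h331, the published facts incl. Skinner Thm C, TL₃}: clauses (α) and (γ∖α) by §2
  of part 1 (their shape binders unused — the UB road is blind to the carrier count and to the Kodaira shape), the
  ¬(ram) ∧ surj clause by §3.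

HONEST FRAMING: implications only; UB∃ᴮ@3 is SOURCELESS at `p = 3` (the cell's memo proof of UB is `p ≥ 5`); TL₃ open;
H2@3 = one refereed fact (LZZ18). Nothing booked (T7); BSD proved for no curve; item 19109 NOT closed; tam3-p1's
registered Jetchev line is untouched (this is a second road).

References: [JetchevSkinnerWan2017] Thm. 3.3.1, §7.4.2; [Castella2018] Thms. 2.3, 3.1, 3.2, §5; [LiuZhangZhang2018]
Thms. 1.5.1, 1.5.3; [HoffsteinLuo1997]; [Mazur1978] Cor. 4.1; [Miller2011LMS] Def. 1.1.
-/

set_option autoImplicit false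
set_option linter.dupNamespace false

noncomputable section

open scoped Classical NumberField

open WeierstrassCurve NumberField IsDedekindDomain Field PowerSeries
open Literature.NumberTheory.EllipticCurves Literature.NumberTheory.EllipticCurves.GreenbergSelmer
open Literature.NumberTheory.EllipticCurves.ModularForms
open Literature.NumberTheory.EllipticCurves.Rank1Residual
open Literature.NumberTheory.EllipticCurves.Rank1Residual.Typed
open Literature.NumberTheory.EllipticCurves.JetchevSkinnerWan2017
open Literature.NumberTheory.GaloisRepresentations Literature.NumberTheory.GaloisCohomology
open Literature.NumberTheory.Automorphic
open Summit.BirchSwinnertonDyer.Rank1Residual Summit.BirchSwinnertonDyer.Rank1Residual.X11b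
open Summit.BirchSwinnertonDyer.Rank1Residual.X11b.AcSelmer
open Summit.BirchSwinnertonDyer.Rank1Residual.X11b.CongruenceLimit
open Summit.BirchSwinnertonDyer.Rank1Residual.X11b.Halves
open Summit.BirchSwinnertonDyer.Rank1Residual.X11b.Three
open Summit.BirchSwinnertonDyer.BirchSwinnertonDyer.Theorems.SchneiderFreeAdditiveX3

namespace Summit.BirchSwinnertonDyer.BirchSwinnertonDyer.Theorems.EulerHalfUB

/-! ### §3 X11b@3 ∧ surj (any (ram) status): the Euler-system half from UB∃ᴮ@3 + H2@3 + TL₃ -/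

section Surj

/-- **`Typed.MissingUpperBoundAt W 3` on X11b@3 ∧ surj (no (ram) hypothesis either way) from UB∃ᴮ@3, H2@3, PUBLISHED
facts and TL₃** (the twist's
`≥`-half at 3 for a multiplicative, irreducible, rank-zero twist — tam3-p1's registered `stub_twistLowerAtThree`, verbatim).
The odd-`d_K` Manin-good Heegner datum at `p = 3` (`exists_oddHeegnerData`); the sharp bound over `K` (part 1 §1); the
ℚ-descent `missingUpperBoundAt_of_shaIndexBoundSharp_of_odd` (p524850). CONDITIONAL on UB∃ᴮ@3 (sourceless at 3), H2@3
and TL₃; nothing booked. [cite: JetchevSkinnerWan2017, Thm. 3.3.1 and §7.4.2 (arXiv:1512.06894 pp. 11, 31)]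
[cite: HoffsteinLuo1997, Theorem (§1)] [cite: Mazur1978, Cor. 4.1] [cite: Miller2011LMS, Def. 1.1] -/
theorem missingUpperBoundAt_three_of_classX11b_of_surj_of_ubB₃_of_twistLower
    (h331 : thm331_anticyclotomicControl_mult)
    (hGZ : ∀ (N : ℕ) [NeZero N] (W : WeierstrassCurve ℚ) (K : Type) [Field K] [NumberField K],
      gross_zagier N W K)
    (hKo : ∀ (N : ℕ) [NeZero N] (W : WeierstrassCurve ℚ) (K : Type) [Field K] [NumberField K],
      kolyvagin N W K)
    (hGZK : rank_eq_analyticRank_of_analyticRank_le_one) (hmod : hasEntireLFunction_rat)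
    (hnf : exists_isNewformOf) (hHL : HoffsteinLuo1997_exists_twist_L_one_ne_zero)
    (hMaz : mazur_not_dvd_maninConstant_of_odd)
    (W : WeierstrassCurve ℚ) [W.IsElliptic] [W.IsGloballyMinimal]
    (hX : ClassX11b W 3) (hsurj : Surj W 3) (hVal : Three.BDPValueAt₃ W)
    (hUB : ∀ (N : ℕ) [NeZero N] (K : Type) [Field K] [NumberField K] (Dt : ModularParametrizationData W N)
      (H : HeegnerDatum N (NumberField.discr K)) (ι : K →+* ℂ) (P : (W.baseChange K).toAffine.Point),
      ClassX11b W 3 → Surj W 3 → W.conductorNorm ℤ = N → IsImaginaryQuadratic K →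
      Odd (NumberField.discr K) → SatisfiesHeegnerHypothesis N K →
      (W.quadraticTwist (NumberField.discr K : ℚ)).entireLFunction 1 ≠ 0 →
      WeierstrassCurve.Affine.Point.map ι.toRatAlgHom P = heegnerPointComplex Dt H →
      ¬ (3 : ℤ) ∣ Dt.c → ¬ IsOfFinAddOrder P →
      ∀ (κ : ZpExtension K 3), κ.IsAnticyclotomic →
        ∀ (γ : Field.absoluteGaloisGroup K) [Fact (κ.IsTopGenerator γ)]
          (𝔭 : HeightOneSpectrum (𝓞 K)), ((3 : ℕ) : 𝓞 K) ∈ 𝔭.asIdeal →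
          𝔭.asIdeal.ramificationIdx (𝓞 ℚ) = 1 → 𝔭.asIdeal.inertiaDeg (𝓞 ℚ) = 1 →
          ∀ (f : CuspForm (CongruenceSubgroup.Gamma0 N) 2), IsNewformOf W f →
            ∃ ι' : PadicAlgCl 3 ≃+* ℂ, InducesPrime ι' 𝔭 ∧
              ∃ (ΩK : ℂ) (Ωp : (unrIntegers 3)ˣ) (L : UnrSeries 3),
                ΩK ≠ 0 ∧ IsBDPLFunction ι' 𝔭 κ γ f ΩK ((Ωp : unrIntegers 3) : ℂ_[3]) L ∧
                ∀ (𝔭bar : HeightOneSpectrum (𝓞 K)), ((3 : ℕ) : 𝓞 K) ∈ 𝔭bar.asIdeal → 𝔭bar ≠ 𝔭 →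
                  Ideal.span {L} ≤
                    (XAc.charIdeal (W.baseChange K) 3 κ 𝔭bar ∅ γ).map (PowerSeries.map (toUnr 3)))
    -- TL₃: the registered stub `stub_twistLowerAtThree` of 19109's birth skeleton, VERBATIM
    (hTL : ∀ (V : WeierstrassCurve ℚ) [V.IsElliptic] [V.IsGloballyMinimal],
      V.HasMultiplicativeReductionAtPrime 3 → V.HasIrreducibleModPGaloisRep 3 →
      V.entireLFunction 1 ≠ 0 → Finite V.sha →
      ∃ q : ℚ, V.entireLFunction 1 / (V.realPeriodRat : ℂ) = (q : ℂ) ∧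
        padicValRat 3 q ≤ (padicValNat 3 V.shaOrder : ℤ) + padicValNat 3 V.tamagawaProduct -
          2 * padicValNat 3 V.torsionOrder) :
    Typed.MissingUpperBoundAt W 3 := by
  have hNS : integral_neronScaling_of_isGloballyMinimal := integral_neronScaling_of_isGloballyMinimal_holds
  have hX' := hX
  obtain ⟨hr, hp2, hmult, hirr⟩ := hX
  haveI : NeZero (W.conductorNorm ℤ) := ⟨(W.conductorNorm_pos_holds).ne'⟩
  obtain ⟨K, _, _, Dt, H, ι, P, Wd, _, _, Cd, hK, hodd, hpd, hHN, hP, hc, hμ, hLt, hWd⟩ :=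
    exists_oddHeegnerData hnf hHL hMaz hNS W 3 hr hp2 hmult hirr
  -- the twist on its minimal model: multiplicative, irreducible, `L ≠ 0`, finite `Ш`; TL₃ gives its `≥`-half
  have hD0 : (NumberField.discr K : ℚ) ≠ 0 := by exact_mod_cast NumberField.discr_ne_zero K
  haveI hEt : (W.quadraticTwist (NumberField.discr K : ℚ)).IsElliptic := W.isElliptic_quadraticTwist hD0
  have hmultd : Wd.HasMultiplicativeReductionAtPrime 3 :=
    hasMultiplicativeReductionAtPrime_twist_of_heegner' W 3 K hK hHN hmult Cd hWd
  have hirrd : Wd.HasIrreducibleModPGaloisRep 3 :=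
    hasIrreducibleModPGaloisRep_twist_model W 3 K hK.1 hirr Cd hWd
  have hLt' : (W.quadraticTwist (NumberField.discr K : ℚ)).entireLFunction = Wd.entireLFunction := by
    rw [← hWd, entireLFunction_smul]
  have hLd1 : Wd.entireLFunction 1 ≠ 0 := by rw [← hLt']; exact hLt
  have hrd : Wd.analyticRank = 0 := (Wd.analyticRank_eq_zero_iff_holds (hmod Wd)).2 hLd1
  have hfinSd : Finite Wd.sha := (hGZK Wd (by omega)).2
  have htw := hTL Wd hmultd hirrd hLd1 hfinSd
  have hPinf : ¬ IsOfFinAddOrder P :=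
    not_isOfFinAddOrder_of_heegner_of_analyticRank_eq_one W _ K Dt H ι P (hGZ _ W K) hmod hr hK hHN hLt hP
  exact missingUpperBoundAt_of_shaIndexBoundSharp_of_odd W 3 K Dt H ι P (hGZ _ W K) (hKo _ W K) hGZK hmod
    hr hp2 hmult hK hodd hpd hHN hP hc hμ hLt Wd Cd hWd htw
    (fun _ _ ↦ shaIndexBoundSharp_of_ubB₃_at_datum h331 hKo hVal hUB _ K Dt H ι P hX' hsurj rfl hK hodd hHN
      hLt hP hc hPinf)

end Surj

/-! ### §4 The BODY of crux 19109 `EulerHalvesAtThree` (both @3 routes) from UB∃ᴮ@3 + H2@3 + published facts + TL₃ -/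

section Body

/-- **The BODY of `EulerHalvesAtThree` (items: K2@3 `closes` binder h₄, KOLY binder h₅; byte-identical texts) from UB∃ᴮ@3
and H2@3 on every X11b@3 curve, `h331`, the published facts (incl. Skinner 2016 Thm. C at 3 for the (ram) twists) and
TL₃.** Clauses (α) and (γ∖α) [both under (ram)] by part 1 §2 — the Kodaira-shape binders `ShapeAlpha` ∕ `ShapeGamma` ∕
split are NOT used (the UB road is Tamagawa-exact whatever the carriers); the ¬(ram) ∧ surj clause by §3. A ROAD, not a
closure: CONDITIONAL on UB∃ᴮ@3 (sourceless at 3), H2@3 (one refereed fact), TL₃ (open stub); nothing booked (T7).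
[cite: JetchevSkinnerWan2017, Thm. 3.3.1 and §7.4.2 (arXiv:1512.06894 pp. 11, 31)]
[cite: Skinner2016PacificMC, Thm. C (§1)] [cite: Miller2011LMS, Def. 1.1] -/
theorem eulerHalvesAtThree_body_of_ubB₃
    (h331 : thm331_anticyclotomicControl_mult)
    (hGZ : ∀ (N : ℕ) [NeZero N] (W : WeierstrassCurve ℚ) (K : Type) [Field K] [NumberField K],
      gross_zagier N W K)
    (hKo : ∀ (N : ℕ) [NeZero N] (W : WeierstrassCurve ℚ) (K : Type) [Field K] [NumberField K],
      kolyvagin N W K)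
    (hGZK : rank_eq_analyticRank_of_analyticRank_le_one) (hmod : hasEntireLFunction_rat)
    (hnf : exists_isNewformOf) (hHL : HoffsteinLuo1997_exists_twist_L_one_ne_zero)
    (hMaz : mazur_not_dvd_maninConstant_of_odd)
    (hSk : Skinner2016.thmC_padicValRat_bsd_rank_zero)
    -- H2@3 on every X11b@3 curve (a theorem from the LZZ fact)
    (hVal : ∀ (W : WeierstrassCurve ℚ) [W.IsElliptic] [W.IsGloballyMinimal], ClassX11b W 3 → Three.BDPValueAt₃ W)
    -- UB∃ᴮ@3 on every X11b@3 curve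
    (hUB : ∀ (W : WeierstrassCurve ℚ) [W.IsElliptic] [W.IsGloballyMinimal], ClassX11b W 3 →
      ∀ (N : ℕ) [NeZero N] (K : Type) [Field K] [NumberField K] (Dt : ModularParametrizationData W N)
      (H : HeegnerDatum N (NumberField.discr K)) (ι : K →+* ℂ) (P : (W.baseChange K).toAffine.Point),
      ClassX11b W 3 → Surj W 3 → W.conductorNorm ℤ = N → IsImaginaryQuadratic K →
      Odd (NumberField.discr K) → SatisfiesHeegnerHypothesis N K →
      (W.quadraticTwist (NumberField.discr K : ℚ)).entireLFunction 1 ≠ 0 →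
      WeierstrassCurve.Affine.Point.map ι.toRatAlgHom P = heegnerPointComplex Dt H →
      ¬ (3 : ℤ) ∣ Dt.c → ¬ IsOfFinAddOrder P →
      ∀ (κ : ZpExtension K 3), κ.IsAnticyclotomic →
        ∀ (γ : Field.absoluteGaloisGroup K) [Fact (κ.IsTopGenerator γ)]
          (𝔭 : HeightOneSpectrum (𝓞 K)), ((3 : ℕ) : 𝓞 K) ∈ 𝔭.asIdeal →
          𝔭.asIdeal.ramificationIdx (𝓞 ℚ) = 1 → 𝔭.asIdeal.inertiaDeg (𝓞 ℚ) = 1 →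
          ∀ (f : CuspForm (CongruenceSubgroup.Gamma0 N) 2), IsNewformOf W f →
            ∃ ι' : PadicAlgCl 3 ≃+* ℂ, InducesPrime ι' 𝔭 ∧
              ∃ (ΩK : ℂ) (Ωp : (unrIntegers 3)ˣ) (L : UnrSeries 3),
                ΩK ≠ 0 ∧ IsBDPLFunction ι' 𝔭 κ γ f ΩK ((Ωp : unrIntegers 3) : ℂ_[3]) L ∧
                ∀ (𝔭bar : HeightOneSpectrum (𝓞 K)), ((3 : ℕ) : 𝓞 K) ∈ 𝔭bar.asIdeal → 𝔭bar ≠ 𝔭 →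
                  Ideal.span {L} ≤
                    (XAc.charIdeal (W.baseChange K) 3 κ 𝔭bar ∅ γ).map (PowerSeries.map (toUnr 3)))
    -- TL₃: the registered stub `stub_twistLowerAtThree` of 19109's birth skeleton, VERBATIM
    (hTL : ∀ (V : WeierstrassCurve ℚ) [V.IsElliptic] [V.IsGloballyMinimal],
      V.HasMultiplicativeReductionAtPrime 3 → V.HasIrreducibleModPGaloisRep 3 →
      V.entireLFunction 1 ≠ 0 → Finite V.sha →
      ∃ q : ℚ, V.entireLFunction 1 / (V.realPeriodRat : ℂ) = (q : ℂ) ∧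
        padicValRat 3 q ≤ (padicValNat 3 V.shaOrder : ℤ) + padicValNat 3 V.tamagawaProduct -
          2 * padicValNat 3 V.torsionOrder) :
    ∀ (W : WeierstrassCurve ℚ) [W.IsElliptic] [W.IsGloballyMinimal],
      Summit.BirchSwinnertonDyer.Rank1Residual.ClassX11b W 3 →
      (Literature.NumberTheory.EllipticCurves.Rank1Residual.Ram W 3 →
        Summit.BirchSwinnertonDyer.Rank1Residual.X11b.Three.ShapeAlpha W →
        Literature.NumberTheory.EllipticCurves.Rank1Residual.Typed.MissingUpperBoundAt W 3) ∧
      (Literature.NumberTheory.EllipticCurves.Rank1Residual.Ram W 3 → W.HasSplitMultiplicativeReductionAtPrime 3 →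
        ¬ Summit.BirchSwinnertonDyer.Rank1Residual.X11b.Three.ShapeAlpha W →
        Summit.BirchSwinnertonDyer.Rank1Residual.X11b.Three.ShapeGamma W →
        Literature.NumberTheory.EllipticCurves.Rank1Residual.Typed.MissingUpperBoundAt W 3) ∧
      (Literature.NumberTheory.EllipticCurves.Rank1Residual.Surj W 3 →
        ¬ Literature.NumberTheory.EllipticCurves.Rank1Residual.Ram W 3 →
        Literature.NumberTheory.EllipticCurves.Rank1Residual.Typed.MissingUpperBoundAt W 3) := by
  intro W _ _ hX
  refine ⟨fun hram _ ↦ ?_, fun hram _ _ _ ↦ ?_, fun hsurj _ ↦ ?_⟩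
  · exact missingUpperBoundAt_three_of_classX11b_of_ram_of_ubB₃ h331 hGZ hKo hSk hGZK hmod hnf hHL hMaz W hX hram
      (hVal W hX) (hUB W hX)
  · exact missingUpperBoundAt_three_of_classX11b_of_ram_of_ubB₃ h331 hGZ hKo hSk hGZK hmod hnf hHL hMaz W hX hram
      (hVal W hX) (hUB W hX)
  · exact missingUpperBoundAt_three_of_classX11b_of_surj_of_ubB₃_of_twistLower h331 hGZ hKo hGZK hmod hnf hHL hMaz
      W hX hsurj (hVal W hX) (hUB W hX) hTL

end Body

end Summit.BirchSwinnertonDyer.BirchSwinnertonDyer.Theorems.EulerHalfUB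

end
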